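import Summits.Ventures.PercRepro.S1WeightsAB

/-!
# PercRepro — S1 THE THREE-CLASS COUNT OF THE FLAT PROFILE (p2, gen 16; SUBCLAIM-S1 §4 (A12)–(A13))

`S1JointPerFlat3.ncard_rank4_Icc_le_K` charges every rank-`4` flat with `≥ 8` points at the rate `RBK c`. Here the
flats are split into three classes — small (`≤ 7`, rate `RSK c`), middle (`8 ≤ |F| < t`, rate `RB`), huge (`≥ t`,
at most `H` of them; charged their pairs at `7560` plus the constant `7560·βK_c(10)`) — and the pairs of the middle
flats lie in `S₀` with `|S₀| ≤ mS`:

    7560·#{B : r(B) = 4, 5 ≤ |B| ≤ c} ≤ RSK c·Π′_all + (RB − RSK c)·Π′_{mS} + H·7560·βK_c(10).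

* **`ncard_rank4_Icc_le_engine`** — the count, with `t`, `RB`, `H`, `mS` as parameters (the instances are in
  `S1JointPerFlatAB` and `S1CellSubCount`).
Axioms: standard.
-/

open scoped Matroid

namespace PercRepro

namespace S1

open Set

variable {α : Type}

/-- **THE THREE-CLASS COUNT**: with a threshold `t`, a rate `RB` valid for every flat with `8 ≤ |F| < t`, at most
`H` flats with `≥ t` points, and `|S₀| ≤ mS` for the union `S₀` of the circuits with `≤ 5` elements,
`7560·#{B : r(B) = 4, 5 ≤ |B| ≤ c} ≤ RSK c·Π′_all + (RB − RSK c)·Π′_{mS} + H·7560·βK_c(10)`. -/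
theorem ncard_rank4_Icc_le_engine (M : Matroid α) [M.Finite]
    (hcirc : ∀ C, M.IsCircuit C → 3 ≤ C.encard)
    (hline : ∀ L ⊆ M.E, M.eRk L ≤ 2 → L.ncard ≤ 3) (hplane : ∀ P ⊆ M.E, M.eRk P ≤ 3 → P.ncard ≤ 6)
    (hten : ∀ X ⊆ M.E, M.eRk X ≤ 4 → X.ncard ≤ 10) (c : ℕ)
    (t : ℕ) (RB : ℕ) (H : ℕ) (mS : ℕ) (hS0 : (⋃₀ Matroid.circuitsLE M 5).ncard ≤ mS)
    (hw : ∀ F : Set α, F ⊆ M.E → M.closure F = F → M.eRk F = 4 → 8 ≤ F.ncard → F.ncard < t →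
      7560 * ((rank4Five M F).ncard + betaK F.ncard c) ≤ RB * (pairsOf M F).ncard)
    (hcount : ∀ fl : Finset (Set α),
      (∀ F ∈ fl, F ⊆ M.E ∧ M.closure F = F ∧ M.eRk F = 4 ∧ t ≤ F.ncard) → fl.card ≤ H) :
    7560 * {B : Set α | B ⊆ M.E ∧ M.eRk B = 4 ∧ 5 ≤ B.ncard ∧ B.ncard ≤ c}.ncard ≤
      RSK c * ({C : Set α | M.IsCircuit C ∧ C.ncard = 3}.ncard * (M.E.ncard - 3).choose 2 +
        {C : Set α | M.IsCircuit C ∧ C.ncard = 4}.ncard * (M.E.ncard - 4) +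
        {C : Set α | M.IsCircuit C ∧ C.ncard = 5}.ncard) +
      (RB - RSK c) * ({C : Set α | M.IsCircuit C ∧ C.ncard = 3}.ncard * (mS - 3).choose 2 +
        {C : Set α | M.IsCircuit C ∧ C.ncard = 4}.ncard * (mS - 4) +
        {C : Set α | M.IsCircuit C ∧ C.ncard = 5}.ncard) +
      H * (7560 * betaK 10 c) := by
  classical
  -- the union of the short circuits
  set S₀ := ⋃₀ Matroid.circuitsLE M 5 with hS₀
  have hS₀E : S₀ ⊆ M.E := by
    intro x hx
    obtain ⟨C, hC, hxC⟩ := mem_sUnion.1 hx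
    exact Matroid.subset_ground_of_mem_circuitsLE hC hxC
  have hS₀fin : S₀.Finite := M.ground_finite.subset hS₀E
  have hS₀card : S₀.ncard ≤ mS := hS0
  -- the sets to count, as a finset
  set S := {B : Set α | B ⊆ M.E ∧ M.eRk B = 4 ∧ 5 ≤ B.ncard ∧ B.ncard ≤ c} with hS
  have hSfin : S.Finite := M.ground_finite.finite_subsets.subset (fun B hB => hB.1)
  set Sf := hSfin.toFinset with hSf
  have hmemS : ∀ B, B ∈ Sf ↔ B ⊆ M.E ∧ M.eRk B = 4 ∧ 5 ≤ B.ncard ∧ B.ncard ≤ c := by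
    intro B; rw [hSf, Set.Finite.mem_toFinset]; rfl
  -- the flats: the closures of the members of `S`
  set FL := Sf.image M.closure with hFL
  have hflat : ∀ F ∈ FL, F ⊆ M.E ∧ M.closure F = F ∧ M.eRk F = 4 ∧ 5 ≤ F.ncard ∧ F.ncard ≤ 10 := by
    intro F hF
    rw [hFL, Finset.mem_image] at hF
    obtain ⟨B, hB, rfl⟩ := hF
    obtain ⟨hBE, hrB, h5, -⟩ := (hmemS B).1 hB
    have hclE : M.closure B ⊆ M.E := M.closure_subset_ground B
    have hrcl : M.eRk (M.closure B) = 4 := by rw [M.eRk_closure_eq]; exact hrB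
    refine ⟨hclE, M.closure_closure B, hrcl, ?_, hten _ hclE hrcl.le⟩
    exact h5.trans (Set.ncard_le_ncard (M.subset_closure B hBE) (M.ground_finite.subset hclE))
  -- per flat at most `#rank4Five(F) + βK_c(|F|)` members
  have hfib : ∀ F ∈ FL, (Sf.filter (fun B => M.closure B = F)).card ≤
      (rank4Five M F).ncard + betaK F.ncard c := by
    intro F hF
    obtain ⟨hFE, -, -, -, -⟩ := hflat F hF
    have hFfin : F.Finite := M.ground_finite.subset hFE
    set T := Sf.filter (fun B => M.closure B = F) with hT
    have hsplit5 : (T.filter (fun B => B.ncard = 5)).card + (T.filter (fun B => ¬ B.ncard = 5)).card = T.card :=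
      Finset.card_filter_add_card_filter_not _
    have hA : (T.filter (fun B => B.ncard = 5)).card ≤ (rank4Five M F).ncard := by
      rw [← Set.ncard_coe_finset]
      refine Set.ncard_le_ncard ?_ (rank4Five_finite M hFfin)
      intro B hB
      rw [Finset.mem_coe, Finset.mem_filter, hT, Finset.mem_filter, hmemS] at hB
      obtain ⟨⟨⟨hBE, hr4, -, -⟩, hclB⟩, h5⟩ := hB
      refine ⟨?_, h5, hr4⟩
      rw [← hclB]; exact M.subset_closure B hBE
    have hB : (T.filter (fun B => ¬ B.ncard = 5)).card ≤ betaK F.ncard c := by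
      rw [← Set.ncard_coe_finset]
      refine (Set.ncard_le_ncard ?_ (hFfin.finite_subsets.subset (fun B hB => hB.1))).trans
        (ncard_subsets_Icc_six_le hFfin c)
      intro B hB
      rw [Finset.mem_coe, Finset.mem_filter, hT, Finset.mem_filter, hmemS] at hB
      obtain ⟨⟨⟨hBE, -, h5, hc⟩, hclB⟩, hne⟩ := hB
      refine ⟨?_, by omega, hc⟩
      rw [← hclB]; exact M.subset_closure B hBE
    omega
  have hScount : Sf.card ≤ ∑ F ∈ FL, ((rank4Five M F).ncard + betaK F.ncard c) := by
    rw [Finset.card_eq_sum_card_fiberwise (f := M.closure) (t := FL)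
      (fun B hB => Finset.mem_image_of_mem _ hB)]
    exact Finset.sum_le_sum hfib
  -- the pairs of a flat, as a finset
  set AP : Finset (Set α × Set α) :=
    (M.ground_finite.finite_subsets.prod M.ground_finite.finite_subsets).toFinset with hAP
  set PF : Set α → Finset (Set α × Set α) := fun F => AP.filter (fun x => x ∈ pairsOf M F) with hPF
  have hmemPF : ∀ F ∈ FL, ∀ x, x ∈ PF F ↔ x ∈ pairsOf M F := by
    intro F hF x
    rw [hPF]
    simp only [Finset.mem_filter]
    constructor
    · exact fun h => h.2
    · intro hx
      refine ⟨?_, hx⟩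
      rw [hAP, Set.Finite.mem_toFinset, Set.mem_prod]
      exact ⟨(pairsOf_subset hx).1.trans (hflat F hF).1, (pairsOf_subset hx).2.trans (hflat F hF).1⟩
  have hPFcard : ∀ F ∈ FL, (PF F).card = (pairsOf M F).ncard := by
    intro F hF
    rw [← Set.ncard_coe_finset]
    congr 1
    ext x
    rw [Finset.mem_coe, hmemPF F hF]
  -- the pair sets of distinct flats are disjoint (a pair determines its flat)
  have hdisjPF : (FL : Set (Set α)).PairwiseDisjoint PF := by
    intro F hF F' hF' hne
    rw [Function.onFun, Finset.disjoint_left]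
    intro x hx hx'
    rw [hmemPF F hF] at hx
    rw [hmemPF F' hF'] at hx'
    exact hne (by rw [← hx.2.2.2.2, ← hx'.2.2.2.2])
  -- the three classes: small (`≤ 7`), middle (`8 ≤ |F| < t`), huge (`≥ t`)
  set FLs := FL.filter (fun F => F.ncard ≤ 7) with hFLs
  set FLb := FL.filter (fun F => ¬ F.ncard ≤ 7) with hFLb
  set FLm := FLb.filter (fun F => F.ncard < t) with hFLm
  set FLh := FLb.filter (fun F => ¬ F.ncard < t) with hFLh
  have hsplit : ∑ F ∈ FL, 7560 * ((rank4Five M F).ncard + betaK F.ncard c) =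
      ∑ F ∈ FLs, 7560 * ((rank4Five M F).ncard + betaK F.ncard c) +
        (∑ F ∈ FLm, 7560 * ((rank4Five M F).ncard + betaK F.ncard c) +
          ∑ F ∈ FLh, 7560 * ((rank4Five M F).ncard + betaK F.ncard c)) := by
    rw [hFLs, hFLm, hFLh, hFLb, Finset.sum_filter_add_sum_filter_not, Finset.sum_filter_add_sum_filter_not]
  have hsplitP : ∑ F ∈ FL, (PF F).card =
      ∑ F ∈ FLs, (PF F).card + (∑ F ∈ FLm, (PF F).card + ∑ F ∈ FLh, (PF F).card) := by
    rw [hFLs, hFLm, hFLh, hFLb, Finset.sum_filter_add_sum_filter_not, Finset.sum_filter_add_sum_filter_not]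
  have hsplitPb : ∑ F ∈ FLb, (PF F).card = ∑ F ∈ FLm, (PF F).card + ∑ F ∈ FLh, (PF F).card := by
    rw [hFLm, hFLh, Finset.sum_filter_add_sum_filter_not]
  -- the weights of the three classes
  have hws : ∑ F ∈ FLs, 7560 * ((rank4Five M F).ncard + betaK F.ncard c) ≤ RSK c * ∑ F ∈ FLs, (PF F).card := by
    rw [Finset.mul_sum]
    apply Finset.sum_le_sum
    intro F hF
    rw [hFLs, Finset.mem_filter] at hF
    obtain ⟨hFE, hcl, hr, h5, -⟩ := hflat F hF.1
    rw [hPFcard F hF.1]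
    exact weight_small_K M hline hplane hFE hcl hr h5 hF.2 c
  have hwm : ∑ F ∈ FLm, 7560 * ((rank4Five M F).ncard + betaK F.ncard c) ≤ RB * ∑ F ∈ FLm, (PF F).card := by
    rw [Finset.mul_sum]
    apply Finset.sum_le_sum
    intro F hF
    rw [hFLm, Finset.mem_filter, hFLb, Finset.mem_filter] at hF
    obtain ⟨hFE, hcl, hr, -, -⟩ := hflat F hF.1.1
    rw [hPFcard F hF.1.1]
    exact hw F hFE hcl hr (by omega) hF.2
  have hwh : ∑ F ∈ FLh, 7560 * ((rank4Five M F).ncard + betaK F.ncard c) ≤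
      7560 * ∑ F ∈ FLh, (PF F).card + H * (7560 * betaK 10 c) := by
    -- at most `H` huge flats
    have hcard : FLh.card ≤ H := by
      apply hcount
      intro F hF
      rw [hFLh, Finset.mem_filter, hFLb, Finset.mem_filter] at hF
      obtain ⟨hFE, hcl, hr, -, -⟩ := hflat F hF.1.1
      exact ⟨hFE, hcl, hr, by omega⟩
    calc ∑ F ∈ FLh, 7560 * ((rank4Five M F).ncard + betaK F.ncard c)
        ≤ ∑ F ∈ FLh, (7560 * (PF F).card + 7560 * betaK 10 c) := by
          apply Finset.sum_le_sum
          intro F hF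
          rw [hFLh, Finset.mem_filter, hFLb, Finset.mem_filter] at hF
          obtain ⟨hFE, hcl, hr, -, h10⟩ := hflat F hF.1.1
          rw [hPFcard F hF.1.1]
          exact weight_huge_AB M hFE hcl hr h10 c
      _ = 7560 * ∑ F ∈ FLh, (PF F).card + FLh.card * (7560 * betaK 10 c) := by
          rw [Finset.sum_add_distrib, Finset.mul_sum, Finset.sum_const, smul_eq_mul]
      _ ≤ 7560 * ∑ F ∈ FLh, (PF F).card + H * (7560 * betaK 10 c) := by
          have : FLh.card * (7560 * betaK 10 c) ≤ H * (7560 * betaK 10 c) := Nat.mul_le_mul_right _ hcard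
          omega
  -- the circuits of each size; the subsets of `E ∖ C` and of `S₀ ∖ C` of each size
  have hcircfin : ∀ k : ℕ, {C : Set α | M.IsCircuit C ∧ C.ncard = k}.Finite := fun k =>
    M.ground_finite.finite_subsets.subset (fun C hC => hC.1.subset_ground)
  set 𝒞 : ℕ → Finset (Set α) := fun k => (hcircfin k).toFinset with h𝒞
  set 𝒞S : ℕ → Finset (Set α) := fun k => (𝒞 k).filter (fun C => C ⊆ S₀) with h𝒞S
  set 𝓑C : Set α → ℕ → Finset (Set α) := fun C j =>
    ((M.ground_finite.sdiff (t := C)).toFinset.powersetCard j).image (fun s : Finset α => (s : Set α)) with h𝓑C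
  set 𝓑S : Set α → ℕ → Finset (Set α) := fun C j =>
    ((hS₀fin.sdiff (t := C)).toFinset.powersetCard j).image (fun s : Finset α => (s : Set α)) with h𝓑S
  have h𝒞card : ∀ k, (𝒞 k).card = {C : Set α | M.IsCircuit C ∧ C.ncard = k}.ncard := fun k =>
    (Set.ncard_eq_toFinset_card _ (hcircfin k)).symm
  have h𝒞Scard : ∀ k, (𝒞S k).card ≤ {C : Set α | M.IsCircuit C ∧ C.ncard = k}.ncard := fun k => by
    rw [← h𝒞card k]; exact Finset.card_filter_le _ _
  have h𝓑Ccard : ∀ k, ∀ C ∈ 𝒞 k, (𝓑C C (5 - k)).card = (M.E.ncard - k).choose (5 - k) := by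
    intro k C hC
    rw [h𝒞, Set.Finite.mem_toFinset] at hC
    rw [h𝓑C]
    simp only
    rw [card_image_powersetCard (M.ground_finite.sdiff (t := C)) (5 - k),
      Set.ncard_sdiff' hC.1.subset_ground M.ground_finite, hC.2]
  have h𝓑Scard : ∀ k, ∀ C ∈ 𝒞S k, (𝓑S C (5 - k)).card ≤ (mS - k).choose (5 - k) := by
    intro k C hC
    rw [h𝒞S, Finset.mem_filter, h𝒞, Set.Finite.mem_toFinset] at hC
    rw [h𝓑S]
    simp only
    rw [card_image_powersetCard (hS₀fin.sdiff (t := C)) (5 - k), Set.ncard_sdiff' hC.2 hS₀fin, hC.1.2]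
    exact Nat.choose_le_choose _ (by omega)
  -- the data of a pair
  have hpair : ∀ F ∈ FL, ∀ x ∈ pairsOf M F, x.1 ∈ 𝒞 x.1.ncard ∧ x.1.ncard ∈ Finset.Icc 3 5 ∧
      x.2 ⊆ M.E \ x.1 ∧ x.2.ncard = 5 - x.1.ncard := by
    intro F hF x hx
    have hC := hx.1
    have hCfin : x.1.Finite := M.ground_finite.subset hC.subset_ground
    have h3 : 3 ≤ x.1.ncard := by
      have := hcirc _ hC
      rw [← hCfin.cast_ncard_eq] at this
      exact_mod_cast this
    refine ⟨?_, ?_, ?_, ?_⟩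
    · rw [h𝒞, Set.Finite.mem_toFinset]; exact ⟨hC, rfl⟩
    · rw [Finset.mem_Icc]; have := hx.2.2.2.1; omega
    · exact hx.2.2.1.trans (Set.sdiff_subset_sdiff_left (hflat F hF).1)
    · have := hx.2.2.2.1; omega
  -- all pairs of ALL flats lie in `⋃_k ⋃_{C ∈ 𝒞 k} {C} × 𝓑C C (5 − k)`
  have hsub_all : FL.biUnion PF ⊆
      (Finset.Icc 3 5).biUnion (fun k => (𝒞 k).biUnion (fun C => ({C} : Finset (Set α)) ×ˢ 𝓑C C (5 - k))) := by
    intro x hx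
    rw [Finset.mem_biUnion] at hx
    obtain ⟨F, hF, hxF⟩ := hx
    rw [hmemPF F hF] at hxF
    obtain ⟨h1, hk, h2E, h2c⟩ := hpair F hF x hxF
    rw [Finset.mem_biUnion]
    refine ⟨x.1.ncard, hk, ?_⟩
    rw [Finset.mem_biUnion]
    refine ⟨x.1, h1, ?_⟩
    rw [Finset.mem_product, Finset.mem_singleton]
    exact ⟨rfl, (mem_image_powersetCard_iff (M.ground_finite.sdiff (t := x.1)) _ x.2).2 ⟨h2E, h2c⟩⟩
  -- all pairs of the big flats lie in `⋃_k ⋃_{C ∈ 𝒞S k} {C} × 𝓑S C (5 − k)`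
  have hsub_big : FLb.biUnion PF ⊆
      (Finset.Icc 3 5).biUnion (fun k => (𝒞S k).biUnion (fun C => ({C} : Finset (Set α)) ×ˢ 𝓑S C (5 - k))) := by
    intro x hx
    rw [Finset.mem_biUnion] at hx
    obtain ⟨F, hF, hxF⟩ := hx
    rw [hFLb, Finset.mem_filter] at hF
    obtain ⟨hF', h8⟩ := hF
    rw [hmemPF F hF'] at hxF
    obtain ⟨h1, hk, -, h2c⟩ := hpair F hF' x hxF
    obtain ⟨hFE, -, hr, -, -⟩ := hflat F hF'
    have hS0 := pairsOf_subset_S0_of_eight_le M hplane hFE hr (by omega) x hxF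
    rw [Finset.mem_biUnion]
    refine ⟨x.1.ncard, hk, ?_⟩
    rw [Finset.mem_biUnion]
    refine ⟨x.1, ?_, ?_⟩
    · rw [h𝒞S, Finset.mem_filter]
      exact ⟨h1, subset_union_left.trans hS0⟩
    · rw [Finset.mem_product, Finset.mem_singleton]
      refine ⟨rfl, (mem_image_powersetCard_iff (hS₀fin.sdiff (t := x.1)) _ x.2).2 ⟨?_, h2c⟩⟩
      exact Set.subset_sdiff.2 ⟨subset_union_right.trans hS0, (Set.subset_sdiff.1 hxF.2.2.1).2⟩
  have hdisjb : (FLb : Set (Set α)).PairwiseDisjoint PF :=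
    hdisjPF.subset (by rw [hFLb]; exact Finset.coe_subset.2 (Finset.filter_subset _ _))
  have hPall : ∑ F ∈ FL, (PF F).card ≤
      {C : Set α | M.IsCircuit C ∧ C.ncard = 3}.ncard * (M.E.ncard - 3).choose 2 +
        {C : Set α | M.IsCircuit C ∧ C.ncard = 4}.ncard * (M.E.ncard - 4) +
        {C : Set α | M.IsCircuit C ∧ C.ncard = 5}.ncard := by
    rw [← sum_Icc_three_five' (fun k => {C : Set α | M.IsCircuit C ∧ C.ncard = k}.ncard) M.E.ncard]
    calc ∑ F ∈ FL, (PF F).card = (FL.biUnion PF).card := (Finset.card_biUnion hdisjPF).symm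
      _ ≤ ((Finset.Icc 3 5).biUnion
          (fun k => (𝒞 k).biUnion (fun C => ({C} : Finset (Set α)) ×ˢ 𝓑C C (5 - k)))).card :=
          Finset.card_le_card hsub_all
      _ ≤ ∑ k ∈ Finset.Icc 3 5, ((𝒞 k).biUnion (fun C => ({C} : Finset (Set α)) ×ˢ 𝓑C C (5 - k))).card :=
          Finset.card_biUnion_le
      _ ≤ ∑ k ∈ Finset.Icc 3 5, ∑ C ∈ 𝒞 k, (({C} : Finset (Set α)) ×ˢ 𝓑C C (5 - k)).card :=
          Finset.sum_le_sum (fun k _ => Finset.card_biUnion_le)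
      _ = ∑ k ∈ Finset.Icc 3 5, {C : Set α | M.IsCircuit C ∧ C.ncard = k}.ncard * (M.E.ncard - k).choose (5 - k) := by
          apply Finset.sum_congr rfl
          intro k _
          rw [← h𝒞card k, Finset.card_eq_sum_ones (𝒞 k), Finset.sum_mul]
          apply Finset.sum_congr rfl
          intro C hC
          rw [Finset.card_product, Finset.card_singleton, h𝓑Ccard k C hC, one_mul]
  have hPS0 : ∑ F ∈ FLb, (PF F).card ≤
      {C : Set α | M.IsCircuit C ∧ C.ncard = 3}.ncard * (mS - 3).choose 2 +
        {C : Set α | M.IsCircuit C ∧ C.ncard = 4}.ncard * (mS - 4) +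
        {C : Set α | M.IsCircuit C ∧ C.ncard = 5}.ncard := by
    rw [← sum_Icc_three_five' (fun k => {C : Set α | M.IsCircuit C ∧ C.ncard = k}.ncard) (mS)]
    calc ∑ F ∈ FLb, (PF F).card = (FLb.biUnion PF).card := (Finset.card_biUnion hdisjb).symm
      _ ≤ ((Finset.Icc 3 5).biUnion
          (fun k => (𝒞S k).biUnion (fun C => ({C} : Finset (Set α)) ×ˢ 𝓑S C (5 - k)))).card :=
          Finset.card_le_card hsub_big
      _ ≤ ∑ k ∈ Finset.Icc 3 5, ((𝒞S k).biUnion (fun C => ({C} : Finset (Set α)) ×ˢ 𝓑S C (5 - k))).card :=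
          Finset.card_biUnion_le
      _ ≤ ∑ k ∈ Finset.Icc 3 5, ∑ C ∈ 𝒞S k, (({C} : Finset (Set α)) ×ˢ 𝓑S C (5 - k)).card :=
          Finset.sum_le_sum (fun k _ => Finset.card_biUnion_le)
      _ ≤ ∑ k ∈ Finset.Icc 3 5, ∑ _C ∈ 𝒞S k, (mS - k).choose (5 - k) := by
          apply Finset.sum_le_sum
          intro k _
          apply Finset.sum_le_sum
          intro C hC
          rw [Finset.card_product, Finset.card_singleton, one_mul]
          exact h𝓑Scard k C hC
      _ ≤ ∑ k ∈ Finset.Icc 3 5,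
          {C : Set α | M.IsCircuit C ∧ C.ncard = k}.ncard * (mS - k).choose (5 - k) := by
          apply Finset.sum_le_sum
          intro k _
          rw [Finset.sum_const, smul_eq_mul]
          exact Nat.mul_le_mul_right _ (h𝒞Scard k)
  -- assemble: the joint budget with `A = Σ_s + Σ_h`, `X = Σ_m`
  have hSncard : S.ncard = Sf.card := Set.ncard_eq_toFinset_card _ hSfin
  have hAX : (∑ F ∈ FLs, (PF F).card + ∑ F ∈ FLh, (PF F).card) + ∑ F ∈ FLm, (PF F).card ≤
      {C : Set α | M.IsCircuit C ∧ C.ncard = 3}.ncard * (M.E.ncard - 3).choose 2 +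
        {C : Set α | M.IsCircuit C ∧ C.ncard = 4}.ncard * (M.E.ncard - 4) +
        {C : Set α | M.IsCircuit C ∧ C.ncard = 5}.ncard := by
    have : (∑ F ∈ FLs, (PF F).card + ∑ F ∈ FLh, (PF F).card) + ∑ F ∈ FLm, (PF F).card =
        ∑ F ∈ FL, (PF F).card := by rw [hsplitP]; ring
    rw [this]; exact hPall
  have hX : ∑ F ∈ FLm, (PF F).card ≤
      {C : Set α | M.IsCircuit C ∧ C.ncard = 3}.ncard * (mS - 3).choose 2 +
        {C : Set α | M.IsCircuit C ∧ C.ncard = 4}.ncard * (mS - 4) +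
        {C : Set α | M.IsCircuit C ∧ C.ncard = 5}.ncard := by
    have : ∑ F ∈ FLm, (PF F).card ≤ ∑ F ∈ FLb, (PF F).card := by rw [hsplitPb]; omega
    exact this.trans hPS0
  have hjoint := joint_arith (RS := RSK c) (RB := RB) hAX hX
  have hRS : 7560 ≤ RSK c := Nat.le_add_right _ _
  have hh : 7560 * ∑ F ∈ FLh, (PF F).card ≤ RSK c * ∑ F ∈ FLh, (PF F).card := Nat.mul_le_mul_right _ hRS
  calc 7560 * S.ncard = 7560 * Sf.card := by rw [hSncard]
    _ ≤ 7560 * ∑ F ∈ FL, ((rank4Five M F).ncard + betaK F.ncard c) := Nat.mul_le_mul_left _ hScount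
    _ = ∑ F ∈ FL, 7560 * ((rank4Five M F).ncard + betaK F.ncard c) := Finset.mul_sum _ _ _
    _ = ∑ F ∈ FLs, 7560 * ((rank4Five M F).ncard + betaK F.ncard c) +
        (∑ F ∈ FLm, 7560 * ((rank4Five M F).ncard + betaK F.ncard c) +
          ∑ F ∈ FLh, 7560 * ((rank4Five M F).ncard + betaK F.ncard c)) := hsplit
    _ ≤ RSK c * ∑ F ∈ FLs, (PF F).card +
        (RB * ∑ F ∈ FLm, (PF F).card + (7560 * ∑ F ∈ FLh, (PF F).card + H * (7560 * betaK 10 c))) :=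
        add_le_add hws (add_le_add hwm hwh)
    _ ≤ RSK c * (∑ F ∈ FLs, (PF F).card + ∑ F ∈ FLh, (PF F).card) + RB * ∑ F ∈ FLm, (PF F).card +
        H * (7560 * betaK 10 c) := by rw [Nat.mul_add]; omega
    _ ≤ _ := by omega


end S1

end PercRepro
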